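import Summits.KontsevichZagierPeriods.KontsevichZagierPeriods.Theorems.SoloBlindLegendreModulus
import Literature.NumberTheory.Transcendental.KZRelationsLE
import HarnessLib

/-!
# The complete elliptic integrals as one-dimensional representations

The integrands of the complete elliptic integrals of the first and second kind at modulus-square
`μ`,

  `f_μ(x) = 1/√((1-x²)(1-μx²))`  (`K(√μ) = ∫₀¹ f_μ`),  `e_μ(x) = √((1-μx²)/(1-x²))`
  (`E(√μ) = ∫₀¹ e_μ`),

their positivity, domination by the Beta integrand `(1-x)^{-1/2}` (hence integrability on `(0,1)`
for `μ ∈ [0,1)`), `ℚ`-semialgebraicity for algebraic `μ`, and the representations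
`K_μ = [(0,1), f_μ]`, `E_μ = [(0,1), e_μ]` (`ellK`, `ellE`) for real algebraic `μ ∈ (0,1)`.
Used by Legendre's relation in product form (`SoloBlindLegendreProduct`) and by Landen's
transformation (`SoloBlindLandenModulus`, `SoloBlindLandenSecond`).
-/

noncomputable section

namespace Summit.KontsevichZagierPeriods.KontsevichZagierPeriods.Theorems

open Set MeasureTheory
open Literature.ModelTheory.ExponentialFields (IsSemialgebraic)
open Literature.NumberTheory.Transcendental
open Literature.NumberTheory.Transcendental.KZ
open Literature.Analysis.SpecialFunctions.Selberg
  (integrableOn_Ioo_rpow_mul_one_sub_rpow_and_integral_eq)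

namespace SoloBlind

/-! ## The elliptic integrands -/

/-- `f_μ(x) = 1/√((1-x²)(1-μx²))`, the integrand of `K(√μ)`. -/
def ellKf (μ x : ℝ) : ℝ := 1 / Real.sqrt ((1 - x ^ 2) * (1 - μ * x ^ 2))

/-- `e_μ(x) = √((1-μx²)/(1-x²))`, the integrand of `E(√μ)`. -/
def ellEf (μ x : ℝ) : ℝ := Real.sqrt ((1 - μ * x ^ 2) / (1 - x ^ 2))

variable {μ x y : ℝ}

/-- Positivity of the two factors on `(0,1)`, for `μ ∈ [0,1]`. -/
theorem ell_aux (hx : x ∈ Ioo (0:ℝ) 1) (hμ : μ ∈ Icc (0:ℝ) 1) :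
    0 < 1 - x ^ 2 ∧ 0 < 1 - μ * x ^ 2 ∧ 1 - x ≤ 1 - x ^ 2 ∧ 1 - μ ≤ 1 - μ * x ^ 2 := by
  have hx2 : x ^ 2 < 1 := by nlinarith [hx.1, hx.2]
  refine ⟨by linarith, by nlinarith [hμ.2, sq_nonneg x], by nlinarith [hx.1, hx.2],
    by nlinarith [hμ.1, sq_nonneg x]⟩

/-- `0 < f_μ` on `(0,1)`. -/
theorem ellKf_pos (hx : x ∈ Ioo (0:ℝ) 1) (hμ : μ ∈ Icc (0:ℝ) 1) : 0 < ellKf μ x := by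
  obtain ⟨h1, h2, -⟩ := ell_aux hx hμ
  unfold ellKf
  positivity

/-- `e_μ = (1 - μx²) f_μ` on `(0,1)`. -/
theorem ellEf_eq (hx : x ∈ Ioo (0:ℝ) 1) (hμ : μ ∈ Icc (0:ℝ) 1) :
    ellEf μ x = (1 - μ * x ^ 2) * ellKf μ x := by
  obtain ⟨h1, h2, -⟩ := ell_aux hx hμ
  rw [ellEf, ellKf, Real.sqrt_div h2.le, Real.sqrt_mul h1.le]
  have hs : 0 < Real.sqrt (1 - μ * x ^ 2) := Real.sqrt_pos.mpr h2
  have ht : 0 < Real.sqrt (1 - x ^ 2) := Real.sqrt_pos.mpr h1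
  set s := Real.sqrt (1 - μ * x ^ 2) with hs'
  rw [show 1 - μ * x ^ 2 = s ^ 2 from (Real.sq_sqrt h2.le).symm]
  field_simp

/-- `|f_μ(x)| ≤ 1/(√(1-μ) √(1-x))` on `(0,1)`, for `μ ∈ [0,1)`. -/
theorem abs_ellKf_le (hx : x ∈ Ioo (0:ℝ) 1) (hμ : μ ∈ Ico (0:ℝ) 1) :
    |ellKf μ x| ≤ 1 / Real.sqrt (1 - μ) * (1 / Real.sqrt (1 - x)) := by
  obtain ⟨h1, h2, h3, h4⟩ := ell_aux hx (Ico_subset_Icc_self hμ)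
  rw [abs_of_pos (ellKf_pos hx (Ico_subset_Icc_self hμ)), ellKf, Real.sqrt_mul h1.le,
    ← one_div_mul_one_div, mul_comm]
  have hμ' : 0 < 1 - μ := sub_pos.mpr hμ.2
  have hx' : 0 < 1 - x := sub_pos.mpr hx.2
  exact mul_le_mul (one_div_le_one_div_of_le (Real.sqrt_pos.mpr hμ') (Real.sqrt_le_sqrt h4))
    (one_div_le_one_div_of_le (Real.sqrt_pos.mpr hx') (Real.sqrt_le_sqrt h3)) (by positivity)
    (by positivity)

/-- `|e_μ(x)| ≤ 1/(√(1-μ) √(1-x))` on `(0,1)`, for `μ ∈ [0,1)`. -/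
theorem abs_ellEf_le (hx : x ∈ Ioo (0:ℝ) 1) (hμ : μ ∈ Ico (0:ℝ) 1) :
    |ellEf μ x| ≤ 1 / Real.sqrt (1 - μ) * (1 / Real.sqrt (1 - x)) := by
  have hμ' := Ico_subset_Icc_self hμ
  obtain ⟨-, h2, -⟩ := ell_aux hx hμ'
  refine le_trans ?_ (abs_ellKf_le hx hμ)
  rw [ellEf_eq hx hμ', abs_mul, abs_of_pos h2, abs_of_pos (ellKf_pos hx hμ')]
  have : 1 - μ * x ^ 2 ≤ 1 := by nlinarith [hμ.1, sq_nonneg x]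
  nlinarith [ellKf_pos hx hμ']

/-- `f_μ` is measurable. -/
theorem measurable_ellKf (μ : ℝ) : Measurable (ellKf μ) := by
  unfold ellKf; fun_prop

/-- `e_μ` is measurable. -/
theorem measurable_ellEf (μ : ℝ) : Measurable (ellEf μ) := by
  unfold ellEf; fun_prop

/-- `1/√(1-x)` is integrable on `(0,1)` (it is the Beta integrand `t⁰(1-t)^{-1/2}`). -/
theorem integrableOn_one_div_sqrt_one_sub' :
    IntegrableOn (fun x : ℝ => 1 / Real.sqrt (1 - x)) (Ioo 0 1) :=
  (integrableOn_Ioo_rpow_mul_one_sub_rpow_and_integral_eq (a := 1) (b := 1 / 2) one_pos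
    (by norm_num)).1.congr_fun (fun _ hx => (one_div_sqrt_eq_betaIntegrand hx).symm)
    measurableSet_Ioo

/-- A measurable function dominated by `K/√(1-x)` is integrable on `(0,1)`. -/
theorem integrableOn_Ioo_of_le {g : ℝ → ℝ} (hg : Measurable g) (K : ℝ)
    (hle : ∀ x ∈ Ioo (0:ℝ) 1, |g x| ≤ K * (1 / Real.sqrt (1 - x))) : IntegrableOn g (Ioo 0 1) := by
  refine Integrable.mono' (integrableOn_one_div_sqrt_one_sub'.const_mul K)
    hg.aestronglyMeasurable ?_
  exact (ae_restrict_iff' measurableSet_Ioo).mpr (Filter.Eventually.of_forall fun x hx => by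
    rw [Real.norm_eq_abs]; exact hle x hx)

/-- `f_μ` is integrable on `(0,1)` for `μ ∈ [0,1)`. -/
theorem integrableOn_ellKf (hμ : μ ∈ Ico (0:ℝ) 1) : IntegrableOn (ellKf μ) (Ioo 0 1) :=
  integrableOn_Ioo_of_le (measurable_ellKf μ) _ fun _ hx => abs_ellKf_le hx hμ

/-- `e_μ` is integrable on `(0,1)` for `μ ∈ [0,1)`. -/
theorem integrableOn_ellEf (hμ : μ ∈ Ico (0:ℝ) 1) : IntegrableOn (ellEf μ) (Ioo 0 1) :=
  integrableOn_Ioo_of_le (measurable_ellEf μ) _ fun _ hx => abs_ellEf_le hx hμ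

section semialgebraic

variable {k : ℕ} {W : Set (Fin k → ℝ)} {a : (Fin k → ℝ) → ℝ} (ha : IsSemialgebraicFunOn ℚ W a)
  (hμa : IsAlgebraic ℚ μ)
include ha hμa

/-- `f_μ` of a semialgebraic argument is semialgebraic (`μ` algebraic). -/
theorem isSemialgebraicFunOn_ellKf : IsSemialgebraicFunOn ℚ W fun w => ellKf μ (a w) := by
  have h1 := isSemialgebraicFunOn_const_of_isAlgebraic ha.isSemialgebraic_holds isAlgebraic_one
  have hm := isSemialgebraicFunOn_const_of_isAlgebraic ha.isSemialgebraic_holds hμa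
  exact (((h1.fun_sub (ha.fun_pow 2)).fun_mul (h1.fun_sub (hm.fun_mul (ha.fun_pow 2)))).fun_sqrt
    |>.fun_inv).congr fun w _ => by simp only [ellKf, one_div]

/-- `e_μ` of a semialgebraic argument is semialgebraic (`μ` algebraic). -/
theorem isSemialgebraicFunOn_ellEf : IsSemialgebraicFunOn ℚ W fun w => ellEf μ (a w) := by
  have h1 := isSemialgebraicFunOn_const_of_isAlgebraic ha.isSemialgebraic_holds isAlgebraic_one
  have hm := isSemialgebraicFunOn_const_of_isAlgebraic ha.isSemialgebraic_holds hμa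
  exact (((h1.fun_sub (hm.fun_mul (ha.fun_pow 2))).fun_mul (h1.fun_sub (ha.fun_pow 2)).fun_inv)
    |>.fun_sqrt).congr fun w _ => by simp only [ellEf, div_eq_mul_inv]

end semialgebraic

/-! ## The representations `K_μ`, `E_μ` -/

section reps

variable (μ : ℝ) (hμa : IsAlgebraic ℚ μ) (hμ : μ ∈ Ioo (0:ℝ) 1)

/-- **`K_μ = [(0,1), 1/√((1-x²)(1-μx²))]`** (value `K(√μ)`). -/
def ellK : IntegralRep 1 :=
  lineRep (Ioo 0 1) (ellKf μ) (isSemialgebraic_line_Ioo isAlgebraic_zero isAlgebraic_one)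
    (isSemialgebraicFunOn_ellKf (isSemialgebraicFunOn_apply
      (isSemialgebraic_line_Ioo isAlgebraic_zero isAlgebraic_one) 0) hμa)
    (integrableOn_ellKf (Ioo_subset_Ico_self hμ))

/-- **`E_μ = [(0,1), √((1-μx²)/(1-x²))]`** (value `E(√μ)`). -/
def ellE : IntegralRep 1 :=
  lineRep (Ioo 0 1) (ellEf μ) (isSemialgebraic_line_Ioo isAlgebraic_zero isAlgebraic_one)
    (isSemialgebraicFunOn_ellEf (isSemialgebraicFunOn_apply
      (isSemialgebraic_line_Ioo isAlgebraic_zero isAlgebraic_one) 0) hμa)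
    (integrableOn_ellEf (Ioo_subset_Ico_self hμ))

/-- The domain of `K_μ`. -/
@[simp] theorem ellK_domain : (ellK μ hμa hμ).domain = line (Ioo 0 1) := rfl

/-- The integrand of `K_μ`. -/
@[simp] theorem ellK_integrand : (ellK μ hμa hμ).integrand = fun x => ellKf μ (x 0) := rfl

/-- The domain of `E_μ`. -/
@[simp] theorem ellE_domain : (ellE μ hμa hμ).domain = line (Ioo 0 1) := rfl

/-- The integrand of `E_μ`. -/
@[simp] theorem ellE_integrand : (ellE μ hμa hμ).integrand = fun x => ellEf μ (x 0) := rfl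

/-- The value of `K_μ` is `K(√μ) = ∫₀¹ dx/√((1-x²)(1-μx²))`. -/
theorem ellK_value : (ellK μ hμa hμ).value = ∫ x in Ioo (0:ℝ) 1, ellKf μ x := value_lineRep

/-- The value of `E_μ` is `E(√μ) = ∫₀¹ √((1-μx²)/(1-x²)) dx`. -/
theorem ellE_value : (ellE μ hμa hμ).value = ∫ x in Ioo (0:ℝ) 1, ellEf μ x := value_lineRep

end reps

end SoloBlind

end Summit.KontsevichZagierPeriods.KontsevichZagierPeriods.Theorems
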